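import Summits.QuantumFields.YangMills.Theorems.BalabanUVNodesN19TiltedPriceInteriorWitness

/-!
# YM-DAG node N19 (= NE7 proper) — THE INTERIOR PRICE FROM BELOW, module 2∕3: detuning to BERNSTEIN — at every interior source `s` the
# grid-Chebyshev pair has `t`-derivative `≥ ε·M∕(32√(l₀² − s²))`

Cell `pub-ymgap`, HUMAN RULING D-0062 (Track A), R141 (C) wider-strategy seat `pub-ymgap-dag-n19-e` (strategy s3 = ALTERNATIVE CURRENCY), generation
g16, module 2 of 3 (siblings: `…N19TiltedPriceInteriorWitness` — the detuned weights and the phase lemma; `…N19TiltedPriceInteriorTwoSided` — the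
probability-law level, two-sided).  Route `Summits/QuantumFields/YangMills/Theses/BalabanUVNodes.lean` rev 23, cluster item K3⁶ «SpineGivenEndpointR13SepCoPR»
(stmt-QuantumFields-20509); filed `--supports` that item `--as helper` (it proves no registered stub).  COUNT-NEUTRAL: elementary real analysis over Mathlib
(`Real.abs_exp_sub_one_le`, `Real.add_one_le_exp`, `Real.sqrt`) + module 1 BY NAME (`exists_expsum_witness_detuned`, `exists_detune_U`, the two `exp`
inequalities) + p509390's `abs_eval_U_zero_eq_one` + the tree's `Literature.Analysis.ODE.exp_sub_one_le_mul_exp`; NOT a discharge claim.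

WHAT IT SAYS.  ★★ `exists_detune_bernstein`: for `0 < l₀`, `|s| < l₀` and odd `M` with `4l₀(8 + l₀) ≤ M·(l₀ − |s|)` and, if `s ≠ 0`, `4πl₀ ≤ M·|s|`,
there is `r ∈ [r₀, 2r₀]` (`r₀ = e^{l₀∕M} − 1`) with `M∕(32√(l₀² − s²)) ≤ e^{s∕M}·|U_{M−1}((e^{s∕M} − 1)∕r)|∕r` — module 1's ★ `exists_detune_U` at the image
`y₀ = |e^{s∕M} − 1|∕r₀` of the source (`source_image_bounds`: `(|s|∕l₀)(1 − 2l₀∕M) ≤ y₀ ≤ 1 − (l₀ − |s|)∕(4l₀)`, from `|σ|e^{−|σ|} ≤ |e^σ − 1| ≤ e^{|σ|} − 1`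
and `l₀∕M ≤ r₀ ≤ 2l₀∕M`, `expm1_window_bounds`), `r := |e^{s∕M} − 1|∕x`, and the algebra `√(1 − y₀²) ≤ 2√(l₀² − s²)∕l₀` (`sqrt_one_sub_sq_image_le`); for
`s = 0`, `r = r₀` and p509390's `|U_{M−1}(0)| = 1` (p517472's centre case).  Hence ★★ `exists_expsum_witness_interior`: weights `w_0, …, w_M` with `Σ w_j = 0`,
`Σ |w_j| = 2`, `2(1 + 4M∕l₀)^{−M} ≤ ε ≤ 4(l₀e^{l₀}∕M)^M`, `|Σ_j w_j e^{tj∕M}| ≤ ε` on `|t| ≤ l₀` and `ε·M∕(32√(l₀² − s²)) ≤ |Σ_j w_j (j∕M) e^{sj∕M}|` —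
BERNSTEIN'S SHAPE FROM BELOW at every interior source (module 3 turns it into two probability laws with close cgf's and far tilted means).

KERNEL-CHECKED (0 `def`, 0 `sorry`): `expm1_window_bounds`, `source_image_bounds`, `sqrt_one_sub_sq_image_le` [folklore arithmetic] · ★★ `exists_detune_bernstein` ·
★★ `exists_expsum_witness_interior`.  NOT claimed: optimal constants (`1∕32`; the thresholds `4l₀(8 + l₀)`, `4πl₀` are convenient, not sharp).

HONEST FRAMING (binding).  Elementary; NO consumer in the DAG today; value = optimality certificate of p528923's interior price.  Nothing of
[Balaban1987RG1]–[Balaban1989LargeFieldII] or [King1986] is asserted, quoted or instantiated; NE7 ∕ NE7b ∕ NE7c NOT PRINTED, NOT proved; N19 NOT discharged;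
Track A count unmoved (typed 28∕28 · discharged 5∕27 · A 5∕28).  One finite `T⁴` programme at fixed `ε`; nothing continuum ∕ `ℝ⁴` ∕ OS ∕ mass-gap ∕ Clay.
THEOREMS ONLY; standard axioms; no cite tags.
-/

set_option autoImplicit false

noncomputable section

open Polynomial Real Finset

namespace Summit.QuantumFields.YangMills.Theorems.BalabanUVNodesN19TiltedPriceInteriorBernstein

open Summit.QuantumFields.YangMills.Theorems.BalabanUVNodesN19NoLinearPriceWitness (abs_eval_U_zero_eq_one)
open Summit.QuantumFields.YangMills.Theorems.BalabanUVNodesN19TiltedPriceInteriorWitness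

/-! ## §1–§2 The image of a source, detuning to Bernstein, the interior witness -/

/-- The window scale `r₀ = e^{l₀∕M} − 1`: `l₀∕M ≤ r₀ ≤ 2l₀∕M` and `r₀ ≤ (l₀∕M)e^{l₀∕M}` once `4l₀ ≤ M`. [folklore] -/
theorem expm1_window_bounds {l₀ : ℝ} (hl₀ : 0 < l₀) {M : ℕ} (hM : 4 * l₀ ≤ M) :
    l₀ / M ≤ Real.exp (l₀ / M) - 1 ∧ Real.exp (l₀ / M) - 1 ≤ 2 * (l₀ / M) ∧
      Real.exp (l₀ / M) - 1 ≤ l₀ / M * Real.exp (l₀ / M) ∧ l₀ / M ≤ 1 / 4 := by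
  have hMr : (0 : ℝ) < M := lt_of_lt_of_le (by positivity) hM
  have hlM : 0 < l₀ / M := div_pos hl₀ hMr
  have hlM4 : l₀ / M ≤ 1 / 4 := by rw [div_le_iff₀ hMr]; linarith
  refine ⟨by linarith [Real.add_one_le_exp (l₀ / M)], ?_, Literature.Analysis.ODE.exp_sub_one_le_mul_exp _, hlM4⟩
  have h := Real.abs_exp_sub_one_le (x := l₀ / M) (by rw [abs_of_pos hlM]; linarith)
  rw [abs_of_pos hlM] at h
  exact (le_abs_self _).trans h

/-- THE IMAGE OF A SOURCE.  For `|s| < l₀` and `4l₀ ≤ M`, `y₀ = |e^{s∕M} − 1|∕(e^{l₀∕M} − 1)` satisfies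
`(|s|∕l₀)(1 − 2l₀∕M) ≤ y₀ ≤ 1 − (l₀ − |s|)∕(4l₀)` (module 1's two `exp` inequalities and `expm1_window_bounds`). [folklore] -/
theorem source_image_bounds {l₀ s : ℝ} (hl₀ : 0 < l₀) (hs : |s| < l₀) {M : ℕ} (hM : 4 * l₀ ≤ M) :
    |s| / l₀ * (1 - 2 * (l₀ / M)) ≤ |Real.exp (s / M) - 1| / (Real.exp (l₀ / M) - 1) ∧
      |Real.exp (s / M) - 1| / (Real.exp (l₀ / M) - 1) ≤ 1 - (l₀ - |s|) / (4 * l₀) := by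
  have hMr : (0 : ℝ) < M := lt_of_lt_of_le (by positivity) hM
  obtain ⟨hr₀lo, hr₀hi, hr₀e, hlM4⟩ := expm1_window_bounds hl₀ hM
  set r₀ : ℝ := Real.exp (l₀ / M) - 1 with hr₀
  have hlM : 0 < l₀ / M := div_pos hl₀ hMr
  have hr₀0 : 0 < r₀ := hlM.trans_le hr₀lo
  have hs0 : 0 ≤ |s| := abs_nonneg s
  have hls : 0 < l₀ - |s| := sub_pos.2 hs
  set a : ℝ := Real.exp (s / M) - 1 with ha
  have hσ : |s / M| = |s| / M := by rw [abs_div, abs_of_pos hMr]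
  have hσle : |s| / M ≤ l₀ / M := div_le_div_of_nonneg_right hs.le hMr.le
  have ha_hi : |a| ≤ Real.exp (|s| / M) - 1 := by
    have := abs_exp_sub_one_le_exp_abs_sub_one (s / M); rwa [hσ] at this
  have ha_lo : |s| / M * Real.exp (-(l₀ / M)) ≤ |a| := by
    have h := abs_mul_exp_neg_abs_le_abs_exp_sub_one (s / M)
    rw [hσ] at h
    refine le_trans ?_ h
    gcongr
  constructor
  · -- from below: `y₀·r₀ = |a| ≥ (|s|/M)e^{−l₀/M}`, `r₀ ≤ (l₀/M)e^{l₀/M}`, `e^{−2l₀/M} ≥ 1 − 2l₀/M`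
    rw [le_div_iff₀ hr₀0]
    have hee : Real.exp (-(l₀ / M)) * Real.exp (l₀ / M) = 1 := by
      rw [← Real.exp_add, neg_add_cancel, Real.exp_zero]
    have he2 : 1 - 2 * (l₀ / M) ≤ Real.exp (-(l₀ / M)) * Real.exp (-(l₀ / M)) := by
      rw [← Real.exp_add]
      have := Real.add_one_le_exp (-(l₀ / M) + -(l₀ / M))
      linarith
    calc |s| / l₀ * (1 - 2 * (l₀ / M)) * r₀
        ≤ |s| / l₀ * (Real.exp (-(l₀ / M)) * Real.exp (-(l₀ / M))) * (l₀ / M * Real.exp (l₀ / M)) := by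
          gcongr
      _ = |s| / M * Real.exp (-(l₀ / M)) * (Real.exp (-(l₀ / M)) * Real.exp (l₀ / M)) := by
          field_simp
      _ = |s| / M * Real.exp (-(l₀ / M)) := by rw [hee, mul_one]
      _ ≤ |a| := ha_lo
  · -- from above: `r₀ − |a| ≥ e^{l₀/M} − e^{|s|/M} ≥ (l₀ − |s|)/M` and `r₀ ≤ 2l₀/M`
    have hgap : (l₀ - |s|) / M ≤ r₀ - |a| := by
      have h1 : Real.exp (l₀ / M) - Real.exp (|s| / M) ≤ r₀ - |a| := by rw [hr₀]; linarith
      refine le_trans ?_ h1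
      have h2 : Real.exp (|s| / M) * ((l₀ - |s|) / M) ≤ Real.exp (|s| / M) * (Real.exp ((l₀ - |s|) / M) - 1) :=
        mul_le_mul_of_nonneg_left (by linarith [Real.add_one_le_exp ((l₀ - |s|) / M)]) (Real.exp_pos _).le
      have h3 : Real.exp (|s| / M) * (Real.exp ((l₀ - |s|) / M) - 1) = Real.exp (l₀ / M) - Real.exp (|s| / M) := by
        rw [mul_sub, ← Real.exp_add, mul_one]; congr 2; ring
      have h4 : (l₀ - |s|) / M ≤ Real.exp (|s| / M) * ((l₀ - |s|) / M) :=
        le_mul_of_one_le_left (div_nonneg hls.le hMr.le) (Real.one_le_exp (by positivity))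
      linarith
    rw [div_le_iff₀ hr₀0]
    have h1 : (l₀ - |s|) / (4 * l₀) * r₀ ≤ (l₀ - |s|) / (4 * l₀) * (2 * (l₀ / M)) :=
      mul_le_mul_of_nonneg_left hr₀hi (by positivity)
    have h2 : (l₀ - |s|) / (4 * l₀) * (2 * (l₀ / M)) = (l₀ - |s|) / M / 2 := by field_simp; ring
    have h3 : 0 ≤ (l₀ - |s|) / M := div_nonneg hls.le hMr.le
    have h4 : r₀ ≤ 1 * r₀ := (one_mul r₀).symm.le
    nlinarith

/-- ALGEBRA OF THE IMAGE: with `(|s|∕l₀)(1 − 2l₀∕M) ≤ y₀`, `4l₀ ≤ M` and `4l₀² ≤ M(l₀ − |s|)`, `√(1 − y₀²) ≤ 2√(l₀² − s²)∕l₀`. [folklore] -/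
theorem sqrt_one_sub_sq_image_le {l₀ s y₀ : ℝ} {M : ℕ} (hl₀ : 0 < l₀) (hs : |s| < l₀) (hM : 4 * l₀ ≤ M)
    (hM' : 4 * l₀ ^ 2 ≤ M * (l₀ - |s|)) (hy : |s| / l₀ * (1 - 2 * (l₀ / M)) ≤ y₀) :
    Real.sqrt (1 - y₀ ^ 2) ≤ 2 * Real.sqrt (l₀ ^ 2 - s ^ 2) / l₀ := by
  have hMr : (0 : ℝ) < M := lt_of_lt_of_le (by positivity) hM
  have hlM4 : l₀ / M ≤ 1 / 4 := by rw [div_le_iff₀ hMr]; linarith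
  have hs0 : 0 ≤ |s| := abs_nonneg s
  have hyl0 : 0 ≤ |s| / l₀ * (1 - 2 * (l₀ / M)) := mul_nonneg (by positivity) (by linarith)
  have hy2 : (|s| / l₀) ^ 2 * (1 - 4 * (l₀ / M)) ≤ y₀ ^ 2 := by
    calc (|s| / l₀) ^ 2 * (1 - 4 * (l₀ / M)) ≤ (|s| / l₀ * (1 - 2 * (l₀ / M))) ^ 2 := by
          rw [mul_pow]
          refine mul_le_mul_of_nonneg_left ?_ (sq_nonneg _)
          nlinarith [sq_nonneg (l₀ / M)]
      _ ≤ y₀ ^ 2 := pow_le_pow_left₀ hyl0 hy 2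
  have hdiv : (|s| / l₀) ^ 2 = s ^ 2 / l₀ ^ 2 := by rw [div_pow, sq_abs]
  rw [hdiv] at hy2
  -- `4(l₀/M)·s² ≤ 4l₀³/M ≤ (l₀² − s²)` from `M(l₀ − |s|) ≥ 4l₀²`
  have hsl : s ^ 2 ≤ l₀ ^ 2 := by
    have := sq_abs s; nlinarith
  have hkey : 4 * (l₀ / M) * l₀ ^ 2 ≤ l₀ ^ 2 - s ^ 2 := by
    have h2 : l₀ ^ 2 - s ^ 2 = (l₀ - |s|) * (l₀ + |s|) := by have := sq_abs s; nlinarith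
    rw [h2, show 4 * (l₀ / M) * l₀ ^ 2 = 4 * l₀ ^ 2 * l₀ / M by ring, div_le_iff₀ hMr]
    calc 4 * l₀ ^ 2 * l₀ ≤ M * (l₀ - |s|) * l₀ := mul_le_mul_of_nonneg_right hM' hl₀.le
      _ ≤ M * (l₀ - |s|) * (l₀ + |s|) := mul_le_mul_of_nonneg_left (by linarith) (by nlinarith)
      _ = (l₀ - |s|) * (l₀ + |s|) * M := by ring
  have h3 : l₀ ^ 2 * (1 - y₀ ^ 2) ≤ 4 * (l₀ ^ 2 - s ^ 2) := by
    have h4 := mul_le_mul_of_nonneg_left hy2 (sq_nonneg l₀)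
    rw [← mul_assoc, mul_div_cancel₀ _ (pow_ne_zero 2 hl₀.ne')] at h4
    have h6 : s ^ 2 * (4 * (l₀ / M)) ≤ l₀ ^ 2 * (4 * (l₀ / M)) := mul_le_mul_of_nonneg_right hsl (by positivity)
    nlinarith
  rw [le_div_iff₀ hl₀, ← Real.sqrt_sq hl₀.le, mul_comm, ← Real.sqrt_mul (sq_nonneg _),
    show (2 : ℝ) = Real.sqrt 4 by rw [show (4 : ℝ) = 2 ^ 2 by norm_num, Real.sqrt_sq zero_le_two],
    ← Real.sqrt_mul (by norm_num : (0 : ℝ) ≤ 4), Real.sqrt_sq hl₀.le]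
  exact Real.sqrt_le_sqrt (by linarith)

/-- **★★ DETUNING TO BERNSTEIN.**  For `0 < l₀`, `|s| < l₀` and odd `M` with `4l₀(8 + l₀) ≤ M·(l₀ − |s|)` and, if `s ≠ 0`, `4πl₀ ≤ M·|s|`, there
is `r` with `r₀ ≤ r ≤ 2r₀` (`r₀ = e^{l₀∕M} − 1`) and `M∕(32√(l₀² − s²)) ≤ e^{s∕M}·|U_{M−1}((e^{s∕M} − 1)∕r)|∕r` — module 1's `exists_detune_U` at
`y₀ = |e^{s∕M} − 1|∕r₀` (`source_image_bounds`, `sqrt_one_sub_sq_image_le`) with `r := |e^{s∕M} − 1|∕x`; for `s = 0`, `r = r₀` and p509390's `|U_{M−1}(0)| = 1`.  The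
thresholds are not optimised. [folklore] -/
theorem exists_detune_bernstein {l₀ s : ℝ} (hl₀ : 0 < l₀) (hs : |s| < l₀) {M : ℕ} (hM : Odd M)
    (hM₁ : 4 * l₀ * (8 + l₀) ≤ M * (l₀ - |s|)) (hM₂ : s ≠ 0 → 4 * π * l₀ ≤ M * |s|) :
    ∃ r : ℝ, Real.exp (l₀ / M) - 1 ≤ r ∧ r ≤ 2 * (Real.exp (l₀ / M) - 1) ∧
      (M : ℝ) / (32 * Real.sqrt (l₀ ^ 2 - s ^ 2)) ≤
        Real.exp (s / M) * |(Chebyshev.U ℝ ((M : ℤ) - 1)).eval (r⁻¹ * (Real.exp (s / M) - 1))| / r := by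
  have hM0 : 0 < M := hM.pos
  have hMr : (0 : ℝ) < M := Nat.cast_pos.mpr hM0
  have hs0 : 0 ≤ |s| := abs_nonneg s
  have hls : 0 < l₀ - |s| := sub_pos.2 hs
  have hMls : (M : ℝ) * (l₀ - |s|) ≤ M * l₀ := mul_le_mul_of_nonneg_left (by linarith) hMr.le
  have hM32 : 4 * (8 + l₀) ≤ (M : ℝ) := le_of_mul_le_mul_right (by linarith [hM₁.trans hMls]) hl₀
  have hM4l : 4 * l₀ ≤ (M : ℝ) := by linarith
  have hM4l2 : 4 * l₀ ^ 2 ≤ M * (l₀ - |s|) := le_trans (by nlinarith) hM₁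
  have hA : 32 * l₀ ≤ M * (l₀ - |s|) := le_trans (by nlinarith) hM₁
  have hM3 : 3 ≤ M := by
    have : (3 : ℝ) ≤ M := by linarith
    exact_mod_cast this
  obtain ⟨hr₀lo, hr₀hi, -, hlM4⟩ := expm1_window_bounds hl₀ hM4l
  set r₀ : ℝ := Real.exp (l₀ / M) - 1 with hr₀
  have hlM : 0 < l₀ / M := div_pos hl₀ hMr
  have hr₀0 : 0 < r₀ := hlM.trans_le hr₀lo
  have hinvr₀ : (M : ℝ) / (4 * l₀) ≤ 1 / (2 * r₀) := by
    rw [div_le_div_iff₀ (by positivity) (by positivity), one_mul]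
    calc (M : ℝ) * (2 * r₀) ≤ M * (2 * (2 * (l₀ / M))) := by gcongr
      _ = 4 * l₀ := by field_simp; ring
  have hsqrt0 : 0 < Real.sqrt (l₀ ^ 2 - s ^ 2) :=
    Real.sqrt_pos.2 (by have := sq_abs s; nlinarith)
  rcases eq_or_ne s 0 with hs0e | hsne
  · -- the centre: `r = r₀`, `|U_{M−1}(0)| = 1`, `1/r₀ ≥ M/(4l₀)`
    subst hs0e
    refine ⟨r₀, le_rfl, by linarith, ?_⟩
    have hsq0 : Real.sqrt (l₀ ^ 2 - (0 : ℝ) ^ 2) = l₀ := by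
      rw [zero_pow two_ne_zero, sub_zero, Real.sqrt_sq hl₀.le]
    rw [hsq0, zero_div, Real.exp_zero, sub_self, mul_zero, abs_eval_U_zero_eq_one hM, one_mul]
    calc (M : ℝ) / (32 * l₀) ≤ M / (4 * l₀) := div_le_div_of_nonneg_left hMr.le (by positivity) (by linarith)
      _ ≤ 1 / (2 * r₀) := hinvr₀
      _ ≤ 1 / r₀ := div_le_div_of_nonneg_left zero_le_one hr₀0 (by linarith)
  · -- an interior source `s ≠ 0`
    have hsa : 0 < |s| := abs_pos.2 hsne
    have hM₂' : 4 * π * l₀ ≤ M * |s| := hM₂ hsne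
    set a : ℝ := Real.exp (s / M) - 1 with ha
    obtain ⟨hylo, hyhi⟩ := source_image_bounds hl₀ hs hM4l
    set y₀ : ℝ := |a| / r₀ with hy₀
    have h12 : 1 / 2 ≤ 1 - 2 * (l₀ / M) := by linarith
    have hylo' : |s| / l₀ * (1 / 2) ≤ y₀ := le_trans (mul_le_mul_of_nonneg_left h12 (by positivity)) hylo
    have hy00 : 0 < y₀ := lt_of_lt_of_le (by positivity) hylo'
    have ha0 : 0 < |a| := by
      have : |a| = y₀ * r₀ := by rw [hy₀, div_mul_cancel₀ _ hr₀0.ne']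
      rw [this]; exact mul_pos hy00 hr₀0
    have hδ : 0 < (l₀ - |s|) / (4 * l₀) := by positivity
    have hy1' : y₀ < 1 := by linarith
    -- the two hypotheses of module 1's `exists_detune_U`
    have hπ1 : π / M ≤ y₀ / 2 := by
      have h1 : π / M ≤ |s| / (4 * l₀) := by
        rw [div_le_div_iff₀ hMr (by positivity)]; linarith
      have e1 : |s| / (4 * l₀) = |s| / l₀ * (1 / 2) / 2 := by field_simp; ring
      linarith
    have h1y : (l₀ - |s|) / (4 * l₀) ≤ 1 - y₀ ^ 2 := by
      have : y₀ * y₀ ≤ y₀ * 1 := mul_le_mul_of_nonneg_left hy1'.le hy00.le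
      rw [sq]; linarith
    have hπ2 : π / M ≤ Real.sqrt (1 - y₀ ^ 2) := by
      rw [Real.le_sqrt (div_nonneg Real.pi_pos.le hMr.le) (hδ.le.trans h1y)]
      refine le_trans ?_ h1y
      have hπ4 : π ^ 2 ≤ 16 := by
        have h := pow_le_pow_left₀ Real.pi_pos.le Real.pi_lt_four.le 2
        norm_num at h
        exact h
      have hM32' : (32 : ℝ) ≤ M := by linarith
      have h1 : (π / M) ^ 2 ≤ 16 / (M : ℝ) ^ 2 := by
        rw [div_pow]; exact div_le_div_of_nonneg_right hπ4 (by positivity)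
      have h2 : 16 / (M : ℝ) ^ 2 ≤ (l₀ - |s|) / (4 * l₀) := by
        rw [div_le_div_iff₀ (by positivity) (by positivity)]
        have h3 : (32 : ℝ) * (32 * l₀) ≤ M * (M * (l₀ - |s|)) := mul_le_mul hM32' hA (by positivity) hMr.le
        have e : (M : ℝ) * (M * (l₀ - |s|)) = (l₀ - |s|) * M ^ 2 := by ring
        linarith
      exact h1.trans h2
    obtain ⟨x, hx1, hx2, hUx, hUnx⟩ := exists_detune_U hM hM3 hy00 hy1' hπ1 hπ2
    have hx0 : 0 < x := lt_of_lt_of_le (half_pos hy00) hx1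
    have hsq : Real.sqrt (1 - y₀ ^ 2) ≤ 2 * Real.sqrt (l₀ ^ 2 - s ^ 2) / l₀ :=
      sqrt_one_sub_sq_image_le hl₀ hs hM4l hM4l2 hylo
    -- `r := |a| / x`
    refine ⟨|a| / x, ?_, ?_, ?_⟩
    · -- `r ≥ |a|/y₀ = r₀`
      calc r₀ = |a| / y₀ := by rw [hy₀]; field_simp
        _ ≤ |a| / x := div_le_div_of_nonneg_left ha0.le hx0 hx2
    · -- `r ≤ |a|/(y₀/2) = 2r₀`
      calc |a| / x ≤ |a| / (y₀ / 2) := div_le_div_of_nonneg_left ha0.le (half_pos hy00) hx1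
        _ = 2 * r₀ := by rw [hy₀]; field_simp
    · -- the main estimate: `e^{s/M} ≥ 3/4`, `|U| ≥ 1/(2√(1−y₀²)) ≥ l₀/(4√(l₀²−s²))`, `x/|a| ≥ 1/(2r₀) ≥ M/(4l₀)`
      have hrinv : (|a| / x)⁻¹ * a = (a / |a|) * x := by rw [inv_div]; ring
      have hUval : 1 / (2 * Real.sqrt (1 - y₀ ^ 2)) ≤
          |(Chebyshev.U ℝ ((M : ℤ) - 1)).eval ((|a| / x)⁻¹ * a)| := by
        rw [hrinv]
        rcases lt_or_gt_of_ne (show a ≠ 0 from abs_pos.1 ha0) with hneg | hpos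
        · rw [abs_of_neg hneg, div_neg, div_self hneg.ne, neg_one_mul]; exact hUnx
        · rw [abs_of_pos hpos, div_self hpos.ne', one_mul]; exact hUx
      have hexps : 3 / 4 ≤ Real.exp (s / M) := by
        have h1 : 3 / 4 ≤ Real.exp (-(l₀ / M)) := by linarith [Real.add_one_le_exp (-(l₀ / M))]
        refine h1.trans (Real.exp_le_exp.2 ?_)
        rw [neg_le, ← neg_div]
        exact (div_le_div_of_nonneg_right ((neg_le_abs s).trans hs.le) hMr.le)
      have hU2 : l₀ / (4 * Real.sqrt (l₀ ^ 2 - s ^ 2)) ≤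
          |(Chebyshev.U ℝ ((M : ℤ) - 1)).eval ((|a| / x)⁻¹ * a)| := by
        refine le_trans ?_ hUval
        have hsy : 0 < Real.sqrt (1 - y₀ ^ 2) := Real.sqrt_pos.2 (hδ.trans_le h1y)
        rw [div_le_div_iff₀ (by positivity) (by positivity), one_mul]
        calc l₀ * (2 * Real.sqrt (1 - y₀ ^ 2)) ≤ l₀ * (2 * (2 * Real.sqrt (l₀ ^ 2 - s ^ 2) / l₀)) := by gcongr
          _ = 4 * Real.sqrt (l₀ ^ 2 - s ^ 2) := by field_simp; ring
      have hxa : (M : ℝ) / (4 * l₀) ≤ x / |a| := by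
        refine hinvr₀.trans ?_
        rw [div_le_div_iff₀ (by positivity) ha0, one_mul]
        calc |a| = y₀ * r₀ := by rw [hy₀, div_mul_cancel₀ _ hr₀0.ne']
          _ ≤ (2 * x) * r₀ := by gcongr; linarith
          _ = x * (2 * r₀) := by ring
      have hfinal : (M : ℝ) / (32 * Real.sqrt (l₀ ^ 2 - s ^ 2)) ≤
          3 / 4 * (l₀ / (4 * Real.sqrt (l₀ ^ 2 - s ^ 2))) * (M / (4 * l₀)) := by
        rw [show 3 / 4 * (l₀ / (4 * Real.sqrt (l₀ ^ 2 - s ^ 2))) * (M / (4 * l₀)) =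
          3 * M / (64 * Real.sqrt (l₀ ^ 2 - s ^ 2)) by field_simp; ring]
        rw [div_le_div_iff₀ (by positivity) (by positivity)]
        have : 0 ≤ (M : ℝ) * Real.sqrt (l₀ ^ 2 - s ^ 2) := by positivity
        nlinarith
      calc (M : ℝ) / (32 * Real.sqrt (l₀ ^ 2 - s ^ 2))
          ≤ 3 / 4 * (l₀ / (4 * Real.sqrt (l₀ ^ 2 - s ^ 2))) * (M / (4 * l₀)) := hfinal
        _ ≤ Real.exp (s / M) * |(Chebyshev.U ℝ ((M : ℤ) - 1)).eval ((|a| / x)⁻¹ * a)| * (x / |a|) := by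
            gcongr
        _ = Real.exp (s / M) * |(Chebyshev.U ℝ ((M : ℤ) - 1)).eval ((|a| / x)⁻¹ * (Real.exp (s / M) - 1))| /
              (|a| / x) := by
            rw [← ha, div_div_eq_mul_div, mul_div_assoc]

/-- **★★ THE INTERIOR BERNSTEIN WITNESS.**  For `0 < l₀`, `|s| < l₀` and odd `M` with `4l₀(8 + l₀) ≤ M·(l₀ − |s|)` and, if `s ≠ 0`, `4πl₀ ≤ M·|s|`:
weights `w_0, …, w_M` with `Σ w_j = 0`, `Σ |w_j| = 2` and an `ε` with `2(1 + 4M∕l₀)^{−M} ≤ ε ≤ 4(l₀e^{l₀}∕M)^M` such that `|Σ_j w_j e^{tj∕M}| ≤ ε` on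
`|t| ≤ l₀` and the `t`-derivative AT THE SOURCE `s` is Bernstein-large: `ε·M∕(32√(l₀² − s²)) ≤ |Σ_j w_j (j∕M) e^{sj∕M}|` (module 1's `exists_expsum_witness_detuned` at the detuned `r`).
[folklore] -/
theorem exists_expsum_witness_interior {l₀ s : ℝ} (hl₀ : 0 < l₀) (hs : |s| < l₀) {M : ℕ} (hM : Odd M)
    (hM₁ : 4 * l₀ * (8 + l₀) ≤ M * (l₀ - |s|)) (hM₂ : s ≠ 0 → 4 * π * l₀ ≤ M * |s|) :
    ∃ (w : ℕ → ℝ) (ε : ℝ), 0 < ε ∧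
      ∑ j ∈ range (M + 1), w j = 0 ∧ ∑ j ∈ range (M + 1), |w j| = 2 ∧
      2 / (1 + 4 * M / l₀) ^ M ≤ ε ∧ ε ≤ 4 * (l₀ * Real.exp l₀ / M) ^ M ∧
      (∀ t : ℝ, |t| ≤ l₀ → |∑ j ∈ range (M + 1), w j * Real.exp (t * j / M)| ≤ ε) ∧
      ε * ((M : ℝ) / (32 * Real.sqrt (l₀ ^ 2 - s ^ 2))) ≤ |∑ j ∈ range (M + 1), w j * (j / M) * Real.exp (s * j / M)| := by
  obtain ⟨r, hr₁, hr₂, hr⟩ := exists_detune_bernstein hl₀ hs hM hM₁ hM₂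
  obtain ⟨w, ε, hε, h0, h2, hlo, hhi, hwin, hder⟩ := exists_expsum_witness_detuned hl₀ hM hr₁ hr₂
  have hM0 : (0 : ℝ) < M := Nat.cast_pos.mpr hM.pos
  have hr₀0 : 0 < Real.exp (l₀ / M) - 1 := by
    have h1 := div_pos hl₀ hM0
    have := Real.add_one_lt_exp h1.ne'
    linarith
  have hr0 : 0 < r := hr₀0.trans_le hr₁
  refine ⟨w, ε, hε, h0, h2, hlo, hhi, hwin, ?_⟩
  rw [hder s, abs_mul, abs_of_pos hε, abs_div, abs_mul, abs_of_pos (Real.exp_pos _), abs_of_pos hr0]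
  exact mul_le_mul_of_nonneg_left hr hε.le

end Summit.QuantumFields.YangMills.Theorems.BalabanUVNodesN19TiltedPriceInteriorBernstein

end
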